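import Summits.BirchSwinnertonDyer.BirchSwinnertonDyer.Theorems.PrintX9HowardContainmentLightFrameOfPrintOfNonvanishing
import Summits.BirchSwinnertonDyer.BirchSwinnertonDyer.Theorems.PrintX9CGLSHeegnerClassNonvanishingOfCGS
import Literature.NumberTheory.EllipticCurves.HeegnerStabilizedClassNonvanishingProofs
import HarnessLib

/-!
# `HowardContainmentLightFrameOfPrint` (stmt-BirchSwinnertonDyer-25235) and the untied light containment
# `HowardContainmentLightFrame` (stmt-24424) MODULO CORNUT–VATSAL 2007 THM. 1.10 ONLY — the binder
# `CGLSHeegnerClassNonvanishing` (leaf 27103) eliminated from the untied closers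

Cell `pub/bsd-print-x9`, seat `bsd-line-x9-p1-w2` (g14), write-crux stmt-BirchSwinnertonDyer-25235 (OPEN·aside; LEAD g5
census #13: «misstated as typed — closes modulo the print leaf `CGLSHeegnerClassNonvanishing`», repaired closer p681863
`PrintX9OfPrintNonvanishing.howardContainmentLightFrameOfPrint_of_nonvanishing : CGLSHeegnerClassNonvanishing →
HowardContainmentLightFrameOfPrint`). THEOREMS ONLY; `--supports 25235`; no definition, no named fact, no `sorry`.

WHAT CHANGES. p681863 consumes the binder `CGLSHeegnerClassNonvanishing` (a cite-only RESTATEMENT of CGLS 2022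
Thm. 4.1.1 + Rem. 4.1.4 + §3.3: torsion-free `𝔖`, `Λκ_∞(C) ≠ ⊥`, `𝔖/Λκ_∞(C)` torsion, for ALL `(D, C)`) only at the
envelope engine's coherent datum `C₀` and only through the torsion quotient. The new Literature theorem
`exists_coherent_pair_envelope_ne_bot_of_thm110` (file `HeegnerStabilizedClassNonvanishingProofs`, this seat) PROVES
`Λκ_∞(C₀) ≠ ⊥` from the tree's primitive statement-only leaf `CornutVatsal2007.thm110_exists_heegnerCharSum_ne_zero`
(Cornut–Vatsal 2007 Thm. 1.10 for the newform of `E/ℚ`; typed by the cross-ladder literature layer, bsd-littype-06), by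
Kummer theory at the layer `K_{j+1}`, the engine identity (P1″), Mordell–Weil at the layer and a character-sum computation;
torsion-freeness of `𝔖` is the kernel theorem `LambdaAdicSelmerData.noZeroSMulDivisors_of_noPTorsion` and the torsion
quotient is rank–nullity at `Λ`-rank one (`PrintX9Binders.noZeroSMulDivisors_and_isTorsion_quotient_of_finrank_eq_one`,
x9-p2 g3), the rank being read off the item's OWN binder `hCGLS` (CGLS Thm. 4.1.3) resp. `hCGS` (CGS Thm. 6.5.2). Hence:

* `howardContainmentLightFrame_of_thm110_of_cgls :
    CornutVatsal2007.thm110_exists_heegnerCharSum_ne_zero → CGLSHowardDivisibilityLocalized → HowardContainmentLightFrame`;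
* `howardContainmentLightFrame_of_thm110_of_cgs :
    CornutVatsal2007.thm110_exists_heegnerCharSum_ne_zero → CGSHowardDivisibilityPLocalized → HowardContainmentLightFrame`;
* **`howardContainmentLightFrameOfPrint_of_thm110 :
    CornutVatsal2007.thm110_exists_heegnerCharSum_ne_zero → HowardContainmentLightFrameOfPrint`** — the item 25235 with
  its missing binder REPLACED by the primitive Cornut–Vatsal leaf (of its own three binders only `hCGLS` is used).

PROOF = p681863's scaling reduction verbatim (x9-p2's line `torsion-depth-light-ofprint` v3: coherent pair + localized
package + the μ-blind promotion `PrintX9Rescaling.stub_rescaling`), with the package's torsion input now a THEOREM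
(`package_of_envelopeModules_of_ne_bot_of_thm413` / `_of_thm652`).

HONEST FRAMING. (i) Kernel-valid AS TYPED and CONDITIONAL on exactly two leaves: Cornut–Vatsal Thm. 1.10 (`hCV`, a
published theorem, statement-only in Literature) and the item's own print binder (`hCGLS` resp. `hCGS`); `hMZ` and the
unsharp tower are idle as in p681863. (ii) PIN-1 / R0 stand: the untied `∃ F` does not pin the parametrisation — these
theorems are not route currency and change no `closes`. (iii) The item 25235 AS FILED stays open (misstated); its minimal
repaired signature is now `CornutVatsal2007.thm110_exists_heegnerCharSum_ne_zero → HowardContainmentLightFrameOfPrint`.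
«beyond-print theorem»: no. No summit statement is proved; BSD is NOT proved by any of this.

References: [CornutVatsal2007] Thm. 1.10, §1.5 ¶1; [CastellaGrossiLeeSkinner2022] Thm. 4.1.3 + Cor. 3.4.2, Rem. 4.1.4;
[CastellaGrossiSkinner2025] Thm. 6.5.2; [Howard2004HeegnerKolyvagin] §3.3, Thm. 3.3.7, Thm. B; [PerrinRiou1987BSMF] §1 p. 405.
-/

set_option linter.dupNamespace false
set_option autoImplicit false

noncomputable section

open scoped Classical Pointwise
open Literature Literature.NumberTheory.EllipticCurves WeierstrassCurve
  Literature.NumberTheory.EllipticCurves.ModularForms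
  Literature.NumberTheory.EllipticCurves.CastellaGrossiLeeSkinner2022
open Summit.BirchSwinnertonDyer.BirchSwinnertonDyer.Theses.PrintX9

namespace Summit.BirchSwinnertonDyer.BirchSwinnertonDyer.Theorems.PrintX9OfCornutVatsal

/-! ## §1 The localized packages with the torsion input a THEOREM (`Λκ_∞(C) ≠ ⊥` + rank one) -/

/-- Ideal bookkeeping: `(a) · ((b) · I)² = (a·b²) · I²`. [folklore] -/
private theorem span_singleton_mul_sq {R : Type*} [CommSemiring R] (a b : R) (I : Ideal R) :
    Ideal.span {a} * (Ideal.span {b} * I) ^ 2 = Ideal.span {a * b ^ 2} * I ^ 2 := by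
  rw [mul_pow, Ideal.span_singleton_pow, ← mul_assoc, Ideal.span_singleton_mul_span_singleton]

/-- **The localized package from the module-level envelope, `Λκ_∞(C) ≠ ⊥` and CGLS Thm. 4.1.3 at Selmer corank one**:
`𝔖` f.g. of `Λ`-rank one (Thm. 4.1.3), hence — `𝔖` being torsion-free (`E(K)[p] = 0`) — `𝔖/Λκ_∞(C)` torsion by
rank–nullity, `𝔖/ℋ_∞(F)` torsion (reverse envelope) and `(p^m) · I(ℋ_∞(F))² ⊆ char_Λ(X_tors)`.
[cite: CastellaGrossiLeeSkinner2022, Thm. 4.1.3 ("Moreover") with Cor. 3.4.2, Rem. 4.1.4] [cite: PerrinRiou1987BSMF, §1 p. 405] -/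
theorem package_of_envelopeModules_of_ne_bot_of_thm413
    {W : WeierstrassCurve ℚ} [W.IsElliptic] [W.IsGloballyMinimal] {p : ℕ} [Fact p.Prime] [NeZero (W.conductorNorm ℤ)]
    {K : Type} [Field K] [NumberField K] {κ : ZpExtension K p} {γ : Field.absoluteGaloisGroup K}
    {jbar : AlgebraicClosure K →+* ℂ}
    (h413 : thm413_rankOne_charIdeal_torsion_dvd_localized.{0})
    (hyp : Thm413Hypotheses (W.conductorNorm ℤ) W K p κ γ) (hrk : (W.baseChange K).selmerCorank p = 1)
    (D : (W.baseChange K).LambdaAdicSelmerData κ γ) (C : StabilizedHeegnerData (W.conductorNorm ℤ) W K κ jbar)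
    (F : HeegnerFamily (W.conductorNorm ℤ) W K κ jbar) (X : (W.baseChange K).SelmerDualData κ γ)
    {e : ℕ} {g : IwasawaAlgebra p} (hg : g ≠ 0)
    (hfwd : ((p : IwasawaAlgebra p) ^ e) • heegnerModule D F ≤ stabilizedHeegnerModule D C)
    (hrev : g • stabilizedHeegnerModule D C ≤ heegnerModule D F) (hne : stabilizedHeegnerModule D C ≠ ⊥) :
    Module.Finite (IwasawaAlgebra p) D.S ∧ Module.finrank (IwasawaAlgebra p) D.S = 1 ∧
      Module.IsTorsion (IwasawaAlgebra p) (D.S ⧸ heegnerModule D F) ∧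
      ∃ m : ℕ, Ideal.span {((p : IwasawaAlgebra p) ^ m)} * heegnerCharIdeal D F ^ 2 ≤
        Module.charIdeal (IwasawaAlgebra p) (Submodule.torsion (IwasawaAlgebra p) X.X) := by
  obtain ⟨⟨hSfin, hS1⟩, -⟩ := h413 (W.conductorNorm ℤ) W K p κ γ jbar hyp D C X
  haveI := hSfin
  have htorC : Module.IsTorsion (IwasawaAlgebra p) (D.S ⧸ stabilizedHeegnerModule D C) :=
    (Summit.BirchSwinnertonDyer.BirchSwinnertonDyer.Theorems.PrintX9Binders.noZeroSMulDivisors_and_isTorsion_quotient_of_finrank_eq_one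
      D hyp.topGenerator hyp.noPTorsion hS1 hne).2
  have htorF : Module.IsTorsion (IwasawaAlgebra p) (D.S ⧸ heegnerModule D F) :=
    isTorsion_quotient_heegnerModule_of_smul_stabilizedHeegnerModule_le D F C hg hrev htorC
  obtain ⟨n, henv⟩ :=
    exists_span_pow_mul_heegnerCharIdeal_le_stabilizedHeegnerCharIdeal_of_pow_smul_le D F C e hfwd htorF
  obtain ⟨m, hm⟩ := span_pow_mul_sq_le_charIdeal_torsion_of_thm413 h413 hyp hrk D C X
  refine ⟨hSfin, hS1, htorF, m + n * 2, ?_⟩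
  calc Ideal.span {((p : IwasawaAlgebra p) ^ (m + n * 2))} * heegnerCharIdeal D F ^ 2
      = Ideal.span {((p : IwasawaAlgebra p) ^ m)} *
          (Ideal.span {((p : IwasawaAlgebra p) ^ n)} * heegnerCharIdeal D F) ^ 2 := by
        rw [span_singleton_mul_sq, ← pow_mul, ← pow_add]
    _ ≤ Ideal.span {((p : IwasawaAlgebra p) ^ m)} * stabilizedHeegnerCharIdeal D C ^ 2 :=
        Ideal.mul_mono_right (Ideal.pow_right_mono henv 2)
    _ ≤ _ := hm

/-- **The localized package from the envelope, `Λκ_∞(C) ≠ ⊥` and CGS 2025 Thm. 6.5.2** (any Selmer corank; `Λ`-rank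
one of `𝔖` read off Thm. 6.5.2). [cite: CastellaGrossiSkinner2025, Thm. 6.5.2] [cite: CastellaGrossiLeeSkinner2022, Rem. 4.1.4] -/
theorem package_of_envelopeModules_of_ne_bot_of_thm652
    {W : WeierstrassCurve ℚ} [W.IsElliptic] [W.IsGloballyMinimal] {p : ℕ} [Fact p.Prime] [NeZero (W.conductorNorm ℤ)]
    {K : Type} [Field K] [NumberField K] {κ : ZpExtension K p} {γ : Field.absoluteGaloisGroup K}
    {jbar : AlgebraicClosure K →+* ℂ}
    (h652 : CastellaGrossiSkinner2025.thm652_stabilized_rankOne_charIdeal_torsion_dvd_pLocalized.{0})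
    (hyp : Thm413Hypotheses (W.conductorNorm ℤ) W K p κ γ)
    (D : (W.baseChange K).LambdaAdicSelmerData κ γ) (C : StabilizedHeegnerData (W.conductorNorm ℤ) W K κ jbar)
    (F : HeegnerFamily (W.conductorNorm ℤ) W K κ jbar) (X : (W.baseChange K).SelmerDualData κ γ)
    {e : ℕ} {g : IwasawaAlgebra p} (hg : g ≠ 0)
    (hfwd : ((p : IwasawaAlgebra p) ^ e) • heegnerModule D F ≤ stabilizedHeegnerModule D C)
    (hrev : g • stabilizedHeegnerModule D C ≤ heegnerModule D F) (hne : stabilizedHeegnerModule D C ≠ ⊥) :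
    Module.Finite (IwasawaAlgebra p) D.S ∧ Module.finrank (IwasawaAlgebra p) D.S = 1 ∧
      Module.IsTorsion (IwasawaAlgebra p) (D.S ⧸ heegnerModule D F) ∧
      ∃ m : ℕ, Ideal.span {((p : IwasawaAlgebra p) ^ m)} * heegnerCharIdeal D F ^ 2 ≤
        Module.charIdeal (IwasawaAlgebra p) (Submodule.torsion (IwasawaAlgebra p) X.X) := by
  obtain ⟨⟨hSfin, hS1⟩, -, -, -⟩ := h652 (W.conductorNorm ℤ) W K p κ γ jbar hyp D C X
  haveI := hSfin
  have htorC : Module.IsTorsion (IwasawaAlgebra p) (D.S ⧸ stabilizedHeegnerModule D C) :=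
    (Summit.BirchSwinnertonDyer.BirchSwinnertonDyer.Theorems.PrintX9Binders.noZeroSMulDivisors_and_isTorsion_quotient_of_finrank_eq_one
      D hyp.topGenerator hyp.noPTorsion hS1 hne).2
  have htorF : Module.IsTorsion (IwasawaAlgebra p) (D.S ⧸ heegnerModule D F) :=
    isTorsion_quotient_heegnerModule_of_smul_stabilizedHeegnerModule_le D F C hg hrev htorC
  obtain ⟨n, henv⟩ :=
    exists_span_pow_mul_heegnerCharIdeal_le_stabilizedHeegnerCharIdeal_of_pow_smul_le D F C e hfwd htorF
  obtain ⟨m, hm⟩ := CastellaGrossiSkinner2025.span_pow_mul_sq_le_charIdeal_torsion_of_thm652_stabilized h652 hyp D C X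
  refine ⟨hSfin, hS1, htorF, m + n * 2, ?_⟩
  calc Ideal.span {((p : IwasawaAlgebra p) ^ (m + n * 2))} * heegnerCharIdeal D F ^ 2
      = Ideal.span {((p : IwasawaAlgebra p) ^ m)} *
          (Ideal.span {((p : IwasawaAlgebra p) ^ n)} * heegnerCharIdeal D F) ^ 2 := by
        rw [span_singleton_mul_sq, ← pow_mul, ← pow_add]
    _ ≤ Ideal.span {((p : IwasawaAlgebra p) ^ m)} * stabilizedHeegnerCharIdeal D C ^ 2 :=
        Ideal.mul_mono_right (Ideal.pow_right_mono henv 2)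
    _ ≤ _ := hm

/-! ## §2 The untied light containment from Cornut–Vatsal Thm. 1.10 and ONE print binder -/

/-- **`HowardContainmentLightFrame` (stmt-BirchSwinnertonDyer-24424) from Cornut–Vatsal 2007 Thm. 1.10 and CGLS 2022
Thm. 4.1.3**: on a rank-one light X9 frame, the coherent pair `(C, F₀)` on `(Dt, H.β)` WITH `Λκ_∞(C) ≠ ⊥`
(`exists_coherent_pair_envelope_ne_bot_of_thm110`; the frame supplies `K_k ⊆ K[p^{k+1}]` by the landed sharp tower and
`[K[p]:K[1]] = p − 1`), the localized package (`package_of_envelopeModules_of_ne_bot_of_thm413`) and the μ-blind promotion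
by rescaling (`PrintX9Rescaling.stub_rescaling`). Kernel-valid AS TYPED; not route currency (PIN-1 / R0).
[cite: CornutVatsal2007, Thm. 1.10] [cite: CastellaGrossiLeeSkinner2022, Thm. 4.1.3, Cor. 3.4.2, Rem. 4.1.4]
[cite: Howard2004HeegnerKolyvagin, §3.3, Thm. B] [cite: PerrinRiou1987BSMF, §1 p. 405, §3.4 Prop. 10] -/
theorem howardContainmentLightFrame_of_thm110_of_cgls :
    CornutVatsal2007.thm110_exists_heegnerCharSum_ne_zero → CGLSHowardDivisibilityLocalized →
      HowardContainmentLightFrame := by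
  intro hCV hCGLS W _ _ p _ _ K _ _ hX9 hK hodd h3 hHN hHp hirr κ hκ γ hγ Dt H ιC hrk hfin
  letI : Algebra K ℂ := ιC.toAlgebra
  let jbar : AlgebraicClosure K →+* ℂ :=
    (IsAlgClosed.lift (R := K) (M := ℂ) (S := AlgebraicClosure K)).toRingHom
  have hp : p.Prime := Fact.out
  have hX9' := Summit.BirchSwinnertonDyer.BirchSwinnertonDyer.Rank1Residual.classX9_census_of_classX9 W p hX9
  have hp_odd : Odd p := hp.odd_of_ne_two hX9'.ne_two
  have hyp := Summit.BirchSwinnertonDyer.Rank1Residual.X9.thm413Hypotheses_of_lightFrame hX9' hK hodd h3 hHN hHp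
    hκ hγ
  -- the data `𝔖`, `X`
  obtain ⟨D⟩ := LambdaAdicSelmerDataExists.nonempty_lambdaAdicSelmerData (W.baseChange K) p κ hγ
  obtain ⟨X⟩ := (W.baseChange K).nonempty_selmerDualData_holds κ γ hγ
  -- the coherent pair on `(Dt, H.β)` with its module-level envelope AND `Λκ_∞(C) ≠ ⊥` (Cornut–Vatsal)
  obtain ⟨C, F₀, -, -, -, -, hfwd, ⟨g, hg, hrev⟩, hne⟩ :=
    exists_coherent_pair_envelope_ne_bot_of_thm110 (W := W) hCV hK hHN Dt H.dvd_sq_sub jbar hyp.ordinary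
      hX9'.not_dvd_conductorNorm κ hκ hγ
      (fun k ↦ Literature.NumberTheory.EllipticCurves.anticyclotomicTowerSharp K p hp_odd hK κ hκ jbar k)
      (card_ringClassGalOver_prime_one_of_frame hK hodd h3 hp hHp jbar) hyp.noPTorsion D
  have hfwd' : ((p : IwasawaAlgebra p) ^ 0) • heegnerModule D F₀ ≤ stabilizedHeegnerModule D C := by
    rw [pow_zero, one_smul]
    exact hfwd
  -- the localized package from `Λκ_∞(C) ≠ ⊥` and CGLS Thm. 4.1.3 at corank one
  have h413 : thm413_rankOne_charIdeal_torsion_dvd_localized.{0} := hCGLS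
  obtain ⟨hSfin, hS1, htorF, hloc⟩ := package_of_envelopeModules_of_ne_bot_of_thm413 h413 hyp
    (Summit.BirchSwinnertonDyer.Rank1Residual.X9.selmerCorank_eq_one_of_rank_one hrk hfin) D C F₀ X hg hfwd' hrev hne
  -- the μ-blind promotion by rescaling (landed stub of the v3 line)
  obtain ⟨F, hF⟩ := Summit.BirchSwinnertonDyer.BirchSwinnertonDyer.Theorems.PrintX9Rescaling.stub_rescaling W p K hX9
    hK hodd h3 hHN hHp hirr κ hκ γ hγ jbar D F₀ X hSfin hS1 htorF hloc
  exact ⟨jbar, D, F, X, hF⟩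

/-- **`HowardContainmentLightFrame` (24424) from Cornut–Vatsal 2007 Thm. 1.10 and the CGS 2025 Thm. 6.5.2 binder `hCGS`
of the live `closes`** (`CGSHowardDivisibilityPLocalized`, any Selmer corank) — same composition with
`package_of_envelopeModules_of_ne_bot_of_thm652`.
[cite: CornutVatsal2007, Thm. 1.10] [cite: CastellaGrossiSkinner2025, Thm. 6.5.2] [cite: CastellaGrossiLeeSkinner2022, Rem. 4.1.4] -/
theorem howardContainmentLightFrame_of_thm110_of_cgs :
    CornutVatsal2007.thm110_exists_heegnerCharSum_ne_zero → CGSHowardDivisibilityPLocalized →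
      HowardContainmentLightFrame := by
  intro hCV hCGS W _ _ p _ _ K _ _ hX9 hK hodd h3 hHN hHp hirr κ hκ γ hγ Dt H ιC _hrk _hfin
  letI : Algebra K ℂ := ιC.toAlgebra
  let jbar : AlgebraicClosure K →+* ℂ :=
    (IsAlgClosed.lift (R := K) (M := ℂ) (S := AlgebraicClosure K)).toRingHom
  have hp : p.Prime := Fact.out
  have hX9' := Summit.BirchSwinnertonDyer.BirchSwinnertonDyer.Rank1Residual.classX9_census_of_classX9 W p hX9
  have hp_odd : Odd p := hp.odd_of_ne_two hX9'.ne_two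
  have hyp := Summit.BirchSwinnertonDyer.Rank1Residual.X9.thm413Hypotheses_of_lightFrame hX9' hK hodd h3 hHN hHp
    hκ hγ
  obtain ⟨D⟩ := LambdaAdicSelmerDataExists.nonempty_lambdaAdicSelmerData (W.baseChange K) p κ hγ
  obtain ⟨X⟩ := (W.baseChange K).nonempty_selmerDualData_holds κ γ hγ
  obtain ⟨C, F₀, -, -, -, -, hfwd, ⟨g, hg, hrev⟩, hne⟩ :=
    exists_coherent_pair_envelope_ne_bot_of_thm110 (W := W) hCV hK hHN Dt H.dvd_sq_sub jbar hyp.ordinary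
      hX9'.not_dvd_conductorNorm κ hκ hγ
      (fun k ↦ Literature.NumberTheory.EllipticCurves.anticyclotomicTowerSharp K p hp_odd hK κ hκ jbar k)
      (card_ringClassGalOver_prime_one_of_frame hK hodd h3 hp hHp jbar) hyp.noPTorsion D
  have hfwd' : ((p : IwasawaAlgebra p) ^ 0) • heegnerModule D F₀ ≤ stabilizedHeegnerModule D C := by
    rw [pow_zero, one_smul]
    exact hfwd
  have h652 : CastellaGrossiSkinner2025.thm652_stabilized_rankOne_charIdeal_torsion_dvd_pLocalized.{0} := hCGS
  obtain ⟨hSfin, hS1, htorF, hloc⟩ :=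
    package_of_envelopeModules_of_ne_bot_of_thm652 h652 hyp D C F₀ X hg hfwd' hrev hne
  obtain ⟨F, hF⟩ := Summit.BirchSwinnertonDyer.BirchSwinnertonDyer.Theorems.PrintX9Rescaling.stub_rescaling W p K hX9
    hK hodd h3 hHN hHp hirr κ hκ γ hγ jbar D F₀ X hSfin hS1 htorF hloc
  exact ⟨jbar, D, F, X, hF⟩

/-! ## §3 The item `HowardContainmentLightFrameOfPrint` (25235) modulo Cornut–Vatsal Thm. 1.10 only -/

/-- **THE REPAIRED SIGNATURE OF stmt-BirchSwinnertonDyer-25235 WITH A PRIMITIVE LEAF**: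
`CornutVatsal2007.thm110_exists_heegnerCharSum_ne_zero → HowardContainmentLightFrameOfPrint` — the item granted Cornut–Vatsal
2007 Thm. 1.10 (statement-only in Literature) in place of the composite binder `CGLSHeegnerClassNonvanishing` of p681863.
Of the item's own three binders only `hCGLS` (CGLS 2022 Thm. 4.1.3) is used; `hMZ` and the unsharp tower are idle.
As filed the item stays open (misstated); a planner restating it with this text closes it by this theorem at once.
[cite: CornutVatsal2007, Thm. 1.10] [cite: CastellaGrossiLeeSkinner2022, Thm. 4.1.3, Rem. 4.1.4] -/
theorem howardContainmentLightFrameOfPrint_of_thm110 :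
    CornutVatsal2007.thm110_exists_heegnerCharSum_ne_zero → HowardContainmentLightFrameOfPrint :=
  fun hCV _hMZ hCGLS _hTw ↦ howardContainmentLightFrame_of_thm110_of_cgls hCV hCGLS

end Summit.BirchSwinnertonDyer.BirchSwinnertonDyer.Theorems.PrintX9OfCornutVatsal

end
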